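import Mathlib
import HarnessLib

/-!
# Venture HSemireg — the fibre test on monomial complete-intersection fat points:
`O_Z`, `Z = V(x₁^{a₁}, …, x_n^{a_n})`, passes (F3) iff `a_j ≥ n` for every `j`

HONEST FRAMING. Lean leaf for the computation cell `pub-hsemireg` (target seat t-5 gen 12; file of
record `run/shared/lean/pub/pub-hsemireg/target-g6/GRID-BARRIER-t5g9.md` §12.5, 2026-08-23; the
statement is pencil ×2 across seats (t-5 g10 ∣ th-3 g21) and machine ×2 across codes there).
§12.5 of the note computes the (F3) «fibre test» of a hypothetical (β)-object fibre on the
monomial complete-intersection fat point `Z = V(x₁^{a₁}, …, x_n^{a_n})`: by the lci/Koszul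
description `Ext^•(O_Z, O_Z) = O_Z ⊗ Λ(ξ₁, …, ξ_n)` (graded-commutative), the translation classes
are `τ_j = a_j x_j^{a_j−1} ξ_j`, `vol = τ₁⋯τ_n = (∏ a_j x_j^{a_j−1}) ξ₁⋯ξ_n`, a class
`κ = Σ_i p_i ξ_i` is `T`-orthogonal for the `i`-th slot iff `a_j x_j^{a_j−1} p_i = 0` for all
`j ≠ i`, and the product of `n` degree-one classes `κ^{(k)} = Σ_i p^{(k)}_i ξ_i` is
`det(p^{(k)}_i) · ξ₁⋯ξ_n`. So the test «some `n` `T`-orthogonal classes have product `c·vol`,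
`c ∈ k^×`» is a statement about the commutative ring `O_Z = k[x]/(x^a)` alone, and THIS FILE
kernel-checks exactly that statement, phrased upstairs in `MvPolynomial (Fin n) K` modulo the ideal
`I = (X_j^{a_j})`: (1) the `T`-orthogonality condition `X_j^{a_j−1}·p ∈ I (j ≠ i)` holds iff
every monomial of `p` lies in `I` or is divisible by `∏_{l ≠ i} X_l` (`tOrthogonal_iff`, §12.5's
«`p_i ∈ (∏_{j≠i} x_j)`»); (2) if some `a_l < n` then EVERY such determinant lies in `I`
(`det_mem_of_exists_lt` — «all `n`-fold products of `T`-orthogonal classes vanish»), while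
`vol ∉ I` (`vol_not_mem`), so the test fails; (3) if `a_j ≥ n` for all `j` the explicit diagonal
certificate `κ_i = x_i^{a_i−n} (∏_{l≠i} x_l) ξ_i` has product `vol/∏a_j` (`fibreTest_pass_of_le`);
(4) hence the criterion `fibreTest_monomialCI_iff`: PASS ⟺ `∀ j, n ≤ a_j` (lengths `≥ nⁿ`; at
`n = 3` no monomial c.i. fibre of length `< 27` passes — the R1 values `3, 6, 12` included).
Only this finite commutative algebra is formalised: the identification with `Ext` (HKR/Koszul), the
(β)-structure and everything else in §12 of the note are NOT. No object is constructed; nothing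
here bears on HC, HC_CM or HC_AV.
-/

namespace Summit.Ventures.HSemireg

open MvPolynomial Finset

section SupportCalculus

variable {τ : Type*} {R : Type*} [CommSemiring R]

/-- A monomial of a product is a sum of monomials of the factors, so predicates on exponents
propagate through products. [folklore] -/
theorem ci_forall_support_mul [DecidableEq τ] {P Q S : (τ →₀ ℕ) → Prop}
    (h : ∀ a c, P a → Q c → S (a + c)) {f g : MvPolynomial τ R}
    (hf : ∀ m ∈ f.support, P m) (hg : ∀ m ∈ g.support, Q m) :
    ∀ m ∈ (f * g).support, S m := by
  intro m hm
  obtain ⟨a, ha, c, hc, rfl⟩ := Finset.mem_add.mp (support_mul f g hm)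
  exact h a c (hf a ha) (hg c hc)

/-- A finite product of monomials with coefficient `1` is the monomial of the summed exponents.
[folklore] -/
theorem ci_prod_monomial_one {ι : Type*} (s : Finset ι) (v : ι → τ →₀ ℕ) :
    ∏ i ∈ s, (monomial (v i) (1 : R)) = monomial (∑ i ∈ s, v i) 1 := by
  classical
  induction s using Finset.induction_on with
  | empty => simp
  | insert i s hi ih => rw [Finset.prod_insert hi, Finset.sum_insert hi, ih, monomial_mul, one_mul]

end SupportCalculus

variable {K : Type*} {n : ℕ}

section Membership

variable [CommRing K]

/-- Membership in the monomial complete-intersection ideal `I = (X_j^{a_j} : j)`: a polynomial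
lies in `I` iff each of its monomials is divisible by some `X_l^{a_l}`. [folklore] -/
theorem mem_spanXPow_iff (a : Fin n → ℕ) (x : MvPolynomial (Fin n) K) :
    x ∈ Ideal.span (Set.range fun j : Fin n => (X j : MvPolynomial (Fin n) K) ^ a j) ↔
      ∀ m ∈ x.support, ∃ l, a l ≤ m l := by
  have hset : Set.range (fun j : Fin n => (X j : MvPolynomial (Fin n) K) ^ a j) =
      (fun s => monomial s (1 : K)) '' Set.range (fun j : Fin n => Finsupp.single j (a j)) := by
    rw [← Set.range_comp]
    congr 1
    funext j
    simp [X_pow_eq_monomial]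
  rw [hset, mem_ideal_span_monomial_image]
  refine forall₂_congr fun m _ => ?_
  constructor
  · rintro ⟨si, ⟨l, rfl⟩, hle⟩
    exact ⟨l, Finsupp.single_le_iff.mp hle⟩
  · rintro ⟨l, hl⟩
    exact ⟨Finsupp.single l (a l), ⟨l, rfl⟩, Finsupp.single_le_iff.mpr hl⟩

/-- Multiplying by `X_j^e` shifts the membership criterion by `e` in the `j`-th exponent.
[folklore] -/
theorem X_pow_mul_mem_spanXPow_iff (a : Fin n → ℕ) (j : Fin n) (e : ℕ)
    (p : MvPolynomial (Fin n) K) :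
    X j ^ e * p ∈ Ideal.span (Set.range fun j : Fin n => (X j : MvPolynomial (Fin n) K) ^ a j) ↔
      ∀ m ∈ p.support, ∃ l, a l ≤ m l + (Finsupp.single j e : Fin n →₀ ℕ) l := by
  rw [mem_spanXPow_iff, X_pow_eq_monomial]
  constructor
  · intro h m hm
    have hmem : m + Finsupp.single j e ∈ (monomial (Finsupp.single j e) (1 : K) * p).support := by
      rw [mem_support_iff, coeff_monomial_mul', if_pos le_add_self, one_mul, add_tsub_cancel_right]
      exact mem_support_iff.mp hm
    obtain ⟨l, hl⟩ := h _ hmem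
    exact ⟨l, by simpa using hl⟩
  · intro h m' hm'
    rw [mem_support_iff, coeff_monomial_mul'] at hm'
    by_cases hle : Finsupp.single j e ≤ m'
    · rw [if_pos hle, one_mul] at hm'
      obtain ⟨l, hl⟩ := h (m' - Finsupp.single j e) (mem_support_iff.mpr hm')
      refine ⟨l, ?_⟩
      have heq : m' - Finsupp.single j e + Finsupp.single j e = m' := tsub_add_cancel_of_le hle
      have := congrArg (fun f : Fin n →₀ ℕ => f l) heq
      simp only [Finsupp.coe_add, Pi.add_apply] at this
      omega
    · exact absurd (by rw [if_neg hle]) hm'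

/-- **§12.5's orthogonality computation.** For `a_j ≥ 1`: the class `p·ξ_i` is `T`-orthogonal,
i.e. `a_j x_j^{a_j−1}·p = 0` in `O_Z` for every `j ≠ i` (here: `X_j^{a_j−1} p ∈ I`), iff every
monomial of `p` is in `I` or is divisible by every `X_j`, `j ≠ i` — «`p ∈ I + (∏_{j≠i} x_j)`».
[folklore] -/
theorem tOrthogonal_iff (a : Fin n → ℕ) (ha : ∀ j, 1 ≤ a j) (i : Fin n)
    (p : MvPolynomial (Fin n) K) :
    (∀ j, j ≠ i → X j ^ (a j - 1) * p ∈
        Ideal.span (Set.range fun j : Fin n => (X j : MvPolynomial (Fin n) K) ^ a j)) ↔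
      ∀ m ∈ p.support, (∃ l, a l ≤ m l) ∨ ∀ j, j ≠ i → 1 ≤ m j := by
  simp_rw [X_pow_mul_mem_spanXPow_iff]
  constructor
  · intro h m hm
    by_cases hex : ∃ l, a l ≤ m l
    · exact Or.inl hex
    · refine Or.inr fun j hj => ?_
      obtain ⟨l, hl⟩ := h j hj m hm
      by_cases hlj : l = j
      · subst hlj
        have := ha l
        simp only [Finsupp.single_eq_same] at hl
        omega
      · rw [Finsupp.single_apply, if_neg (Ne.symm hlj), add_zero] at hl
        exact absurd ⟨l, hl⟩ hex
  · intro h j hj m hm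
    rcases h m hm with ⟨l, hl⟩ | hall
    · exact ⟨l, le_add_right hl⟩
    · refine ⟨j, ?_⟩
      have := hall j hj
      simp only [Finsupp.single_eq_same]
      omega

/-- **All `n`-fold products vanish when some `a_l < n`.** If every entry of column `i` of `P`
is `T`-orthogonal for slot `i` and some exponent `a_l` is `< n`, then `det P ∈ I`: in `O_Z` the
product `κ^{(1)}⋯κ^{(n)} = det(p) ξ₁⋯ξ_n` of any `n` orthogonal classes is ZERO (each surviving
monomial of `det` has `x_l`-exponent `≥ n − 1 ≥ a_l`). [folklore] -/
theorem det_mem_of_exists_lt (a : Fin n → ℕ) (ha : ∀ j, 1 ≤ a j)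
    (P : Matrix (Fin n) (Fin n) (MvPolynomial (Fin n) K))
    (hW : ∀ k i j, j ≠ i → X j ^ (a j - 1) * P k i ∈
      Ideal.span (Set.range fun j : Fin n => (X j : MvPolynomial (Fin n) K) ^ a j))
    (hlt : ∃ l, a l < n) :
    P.det ∈ Ideal.span (Set.range fun j : Fin n => (X j : MvPolynomial (Fin n) K) ^ a j) := by
  classical
  have hcol : ∀ k i, ∀ m ∈ (P k i).support, (∃ l, a l ≤ m l) ∨ ∀ j, j ≠ i → 1 ≤ m j :=
    fun k i => (tOrthogonal_iff a ha i (P k i)).mp (fun j hj => hW k i j hj)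
  -- the exponent predicate propagated through partial products over a set `s` of columns
  have key : ∀ (σ : Equiv.Perm (Fin n)) (s : Finset (Fin n)),
      ∀ m ∈ (∏ i ∈ s, P (σ i) i).support,
        (∃ l, a l ≤ m l) ∨ ∀ j, s.card ≤ m j + (if j ∈ s then 1 else 0) := by
    intro σ s
    induction s using Finset.induction_on with
    | empty =>
      intro m hm
      rw [Finset.prod_empty] at hm
      have := support_monomial_subset (hm : m ∈ (monomial (0 : Fin n →₀ ℕ) (1 : K)).support)
      rw [Finset.mem_singleton] at this
      subst this
      exact Or.inr fun j => by simp
    | insert i s hi ih =>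
      rw [Finset.prod_insert hi]
      refine ci_forall_support_mul (P := fun m => (∃ l, a l ≤ m l) ∨ ∀ j, j ≠ i → 1 ≤ m j)
        (Q := fun m => (∃ l, a l ≤ m l) ∨ ∀ j, s.card ≤ m j + (if j ∈ s then 1 else 0))
        ?_ (hcol (σ i) i) ih
      intro u w hu hw
      rcases hu with ⟨l, hl⟩ | hu
      · exact Or.inl ⟨l, by simp only [Finsupp.coe_add, Pi.add_apply]; omega⟩
      rcases hw with ⟨l, hl⟩ | hw
      · exact Or.inl ⟨l, by simp only [Finsupp.coe_add, Pi.add_apply]; omega⟩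
      refine Or.inr fun j => ?_
      rw [Finset.card_insert_of_notMem hi]
      simp only [Finsupp.coe_add, Pi.add_apply, Finset.mem_insert]
      have hwj := hw j
      by_cases hji : j = i
      · subst hji
        rw [if_neg hi] at hwj
        rw [if_pos (Or.inl rfl)]
        omega
      · have huj := hu j hji
        by_cases hjs : j ∈ s
        · rw [if_pos hjs] at hwj; rw [if_pos (Or.inr hjs)]; omega
        · rw [if_neg hjs] at hwj; rw [if_neg (by tauto)]; omega
  rw [Matrix.det_apply']
  refine Ideal.sum_mem _ fun σ _ => Ideal.mul_mem_left _ _ ?_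
  rw [mem_spanXPow_iff]
  intro m hm
  rcases key σ Finset.univ m hm with h | h
  · exact h
  · obtain ⟨l, hl⟩ := hlt
    refine ⟨l, ?_⟩
    have := h l
    simp only [Finset.card_univ, Fintype.card_fin, Finset.mem_univ, if_true] at this
    omega

/-- `vol = ∏_j a_j x_j^{a_j−1}` is NOT in `I` as soon as `a_j ≥ 1` and `∏ a_j ≠ 0` in `K`
(e.g. characteristic `0`): the top class `τ₁⋯τ_n` is non-zero ((F2), «trace = length»).
[folklore] -/
theorem vol_not_mem (a : Fin n → ℕ) (ha : ∀ j, 1 ≤ a j) (c : K)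
    (hc : c * ∏ j, (a j : K) ≠ 0) :
    C c * ∏ j, (C (a j : K) * X j ^ (a j - 1)) ∉
      Ideal.span (Set.range fun j : Fin n => (X j : MvPolynomial (Fin n) K) ^ a j) := by
  classical
  have hprod : ∏ j, (C (a j : K) * (X j : MvPolynomial (Fin n) K) ^ (a j - 1)) =
      C (∏ j, (a j : K)) * monomial (∑ j, Finsupp.single j (a j - 1)) 1 := by
    rw [Finset.prod_mul_distrib, map_prod, ← ci_prod_monomial_one]
    simp [X_pow_eq_monomial]
  rw [hprod, ← mul_assoc, ← map_mul, C_mul_monomial, mul_one, mem_spanXPow_iff]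
  intro h
  have hsupp : (∑ j, Finsupp.single j (a j - 1) : Fin n →₀ ℕ) ∈
      (monomial (∑ j, Finsupp.single j (a j - 1)) (c * ∏ j, (a j : K))).support := by
    rw [mem_support_iff, coeff_monomial, if_pos rfl]
    exact hc
  obtain ⟨l, hl⟩ := h _ hsupp
  have := ha l
  simp only [Finsupp.coe_finsetSum, Finset.sum_apply, Finsupp.single_apply,
    Finset.sum_ite_eq', Finset.mem_univ, if_true] at hl
  omega

end Membership

section Criterion

variable [Field K]

/-- **FAIL direction of §12.5.** If some `a_l < n` then no `n`-tuple of `T`-orthogonal classes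
has product `c·vol` with `c ≠ 0`: `det P ∈ I` while `c·vol ∉ I`. [folklore] -/
theorem fibreTest_fail_of_exists_lt (a : Fin n → ℕ) (ha : ∀ j, 1 ≤ a j)
    (hK : (∏ j, (a j : K)) ≠ 0) (hlt : ∃ l, a l < n)
    (P : Matrix (Fin n) (Fin n) (MvPolynomial (Fin n) K)) (c : K) (hc : c ≠ 0)
    (hW : ∀ k i j, j ≠ i → X j ^ (a j - 1) * P k i ∈
      Ideal.span (Set.range fun j : Fin n => (X j : MvPolynomial (Fin n) K) ^ a j)) :
    P.det - C c * ∏ j, (C (a j : K) * X j ^ (a j - 1)) ∉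
      Ideal.span (Set.range fun j : Fin n => (X j : MvPolynomial (Fin n) K) ^ a j) := by
  intro h
  have hdet := det_mem_of_exists_lt a ha P hW hlt
  have hvol := Ideal.sub_mem _ hdet h
  rw [sub_sub_cancel] at hvol
  exact vol_not_mem a ha c (mul_ne_zero hc hK) hvol

/-- **PASS direction of §12.5 (explicit certificate).** If `n ≤ a_j` for all `j`, the diagonal
tuple `κ_i = x_i^{a_i−n} (∏_{l≠i} x_l) ξ_i` is `T`-orthogonal and `κ₁⋯κ_n = vol/∏a_j`.
[folklore] -/
theorem fibreTest_pass_of_le (a : Fin n → ℕ) (hK : (∏ j, (a j : K)) ≠ 0)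
    (hle : ∀ j, n ≤ a j) :
    ∃ (P : Matrix (Fin n) (Fin n) (MvPolynomial (Fin n) K)) (c : K), c ≠ 0 ∧
      (∀ k i j, j ≠ i → X j ^ (a j - 1) * P k i ∈
        Ideal.span (Set.range fun j : Fin n => (X j : MvPolynomial (Fin n) K) ^ a j)) ∧
      P.det - C c * ∏ j, (C (a j : K) * X j ^ (a j - 1)) ∈
        Ideal.span (Set.range fun j : Fin n => (X j : MvPolynomial (Fin n) K) ^ a j) := by
  classical
  -- exponent vector of the i-th certificate class: x_i^{a_i - n} · ∏_{l ≠ i} x_l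
  let w : Fin n → (Fin n →₀ ℕ) := fun i =>
    Finsupp.single i (a i - n) + ∑ l ∈ Finset.univ.erase i, Finsupp.single l 1
  have hw : ∀ i j, w i j = if j = i then a i - n else 1 := by
    intro i j
    simp only [w, Finsupp.coe_add, Pi.add_apply, Finsupp.coe_finsetSum, Finset.sum_apply,
      Finsupp.single_apply]
    by_cases hji : j = i
    · subst hji
      simp
    · rw [if_neg (Ne.symm hji), if_neg hji, zero_add]
      rw [Finset.sum_ite_eq' (Finset.univ.erase i) j (fun _ => (1 : ℕ))]
      simp [Finset.mem_erase, hji]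
  refine ⟨Matrix.diagonal fun i => monomial (w i) 1, (∏ j, (a j : K))⁻¹, inv_ne_zero hK, ?_, ?_⟩
  · intro k i j hji
    rw [X_pow_mul_mem_spanXPow_iff]
    intro m hm
    by_cases hki : k = i
    · subst hki
      rw [Matrix.diagonal_apply_eq] at hm
      have := support_monomial_subset hm
      rw [Finset.mem_singleton] at this
      subst this
      refine ⟨j, ?_⟩
      rw [hw, if_neg hji, Finsupp.single_eq_same]
      omega
    · rw [Matrix.diagonal_apply_ne _ hki] at hm
      simp at hm
  · rw [Matrix.det_diagonal, ci_prod_monomial_one]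
    have hsum : (∑ i, w i : Fin n →₀ ℕ) = ∑ j, Finsupp.single j (a j - 1) := by
      ext j
      have hn : 0 < n := Fin.pos j
      simp only [Finsupp.coe_finsetSum, Finset.sum_apply, Finsupp.single_apply,
        Finset.sum_ite_eq', Finset.mem_univ, if_true]
      rw [← Finset.sum_erase_add _ _ (Finset.mem_univ j), hw j j, if_pos rfl]
      have hrest : ∑ i ∈ Finset.univ.erase j, (w i) j = n - 1 := by
        rw [Finset.sum_congr rfl (fun i hi => by
          rw [hw i j, if_neg (Finset.ne_of_mem_erase hi).symm]), Finset.sum_const, smul_eq_mul,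
          mul_one, Finset.card_erase_of_mem (Finset.mem_univ j), Finset.card_univ, Fintype.card_fin]
      rw [hrest]
      have := hle j
      omega
    have hprod : ∏ j, (C (a j : K) * (X j : MvPolynomial (Fin n) K) ^ (a j - 1)) =
        C (∏ j, (a j : K)) * monomial (∑ j, Finsupp.single j (a j - 1)) 1 := by
      rw [Finset.prod_mul_distrib, map_prod, ← ci_prod_monomial_one]
      simp [X_pow_eq_monomial]
    rw [hsum, hprod, ← mul_assoc, ← map_mul, inv_mul_cancel₀ hK, C_1, one_mul, sub_self]
    exact Ideal.zero_mem _

/-- **THE CRITERION (GRID-BARRIER §12.5).** For the monomial complete-intersection fat point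
`Z = V(x₁^{a₁}, …, x_n^{a_n})` (`a_j ≥ 1`, `∏ a_j ≠ 0` in `K`), the (F3) fibre test — «there are
`n` `T`-orthogonal degree-one classes `κ^{(k)} = Σ_i p^{(k)}_i ξ_i` in
`Ext^•(O_Z,O_Z) = O_Z ⊗ Λ(ξ)` with `κ^{(1)}⋯κ^{(n)} = det(p)·ξ₁⋯ξ_n = c·vol`, `c ∈ K^×`»,
written upstairs modulo `I = (X_j^{a_j})` — holds iff `n ≤ a_j` for every `j`; in particular
the length `∏ a_j` of a passing fibre is `≥ nⁿ`. [folklore] -/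
theorem fibreTest_monomialCI_iff (a : Fin n → ℕ) (ha : ∀ j, 1 ≤ a j)
    (hK : (∏ j, (a j : K)) ≠ 0) :
    (∃ (P : Matrix (Fin n) (Fin n) (MvPolynomial (Fin n) K)) (c : K), c ≠ 0 ∧
      (∀ k i j, j ≠ i → X j ^ (a j - 1) * P k i ∈
        Ideal.span (Set.range fun j : Fin n => (X j : MvPolynomial (Fin n) K) ^ a j)) ∧
      P.det - C c * ∏ j, (C (a j : K) * X j ^ (a j - 1)) ∈
        Ideal.span (Set.range fun j : Fin n => (X j : MvPolynomial (Fin n) K) ^ a j)) ↔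
    ∀ j, n ≤ a j := by
  constructor
  · rintro ⟨P, c, hc, hW, hdet⟩
    by_contra hnot
    obtain ⟨l, hl⟩ := not_forall.mp hnot
    exact fibreTest_fail_of_exists_lt a ha hK ⟨l, not_le.mp hl⟩ P c hc hW hdet
  · exact fibreTest_pass_of_le a hK

/-- Characteristic-zero form of the criterion (the hypothesis `∏ a_j ≠ 0` is automatic).
[folklore] -/
theorem fibreTest_monomialCI_iff_charZero [CharZero K] (a : Fin n → ℕ) (ha : ∀ j, 1 ≤ a j) :
    (∃ (P : Matrix (Fin n) (Fin n) (MvPolynomial (Fin n) K)) (c : K), c ≠ 0 ∧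
      (∀ k i j, j ≠ i → X j ^ (a j - 1) * P k i ∈
        Ideal.span (Set.range fun j : Fin n => (X j : MvPolynomial (Fin n) K) ^ a j)) ∧
      P.det - C c * ∏ j, (C (a j : K) * X j ^ (a j - 1)) ∈
        Ideal.span (Set.range fun j : Fin n => (X j : MvPolynomial (Fin n) K) ^ a j)) ↔
    ∀ j, n ≤ a j := by
  refine fibreTest_monomialCI_iff a ha ?_
  rw [Finset.prod_ne_zero_iff]
  intro j _
  have := ha j
  exact_mod_cast (by omega : a j ≠ 0)

/-- The `n = 3` instance used for R1 (§12.5 CONSEQUENCE): a monomial c.i. fat fibre in three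
variables passes the test iff all three exponents are `≥ 3`, so its length is `≥ 27`; the R1
values `|χ| ∈ {3, 6, 12}` are out of reach for such fibres. [folklore] -/
theorem fibreTest_monomialCI_three [CharZero K] (a : Fin 3 → ℕ) (ha : ∀ j, 1 ≤ a j)
    (hpass : ∃ (P : Matrix (Fin 3) (Fin 3) (MvPolynomial (Fin 3) K)) (c : K), c ≠ 0 ∧
      (∀ k i j, j ≠ i → X j ^ (a j - 1) * P k i ∈
        Ideal.span (Set.range fun j : Fin 3 => (X j : MvPolynomial (Fin 3) K) ^ a j)) ∧
      P.det - C c * ∏ j, (C (a j : K) * X j ^ (a j - 1)) ∈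
        Ideal.span (Set.range fun j : Fin 3 => (X j : MvPolynomial (Fin 3) K) ^ a j)) :
    27 ≤ ∏ j, a j := by
  have h := (fibreTest_monomialCI_iff_charZero a ha).mp hpass
  calc (27 : ℕ) = ∏ _j : Fin 3, 3 := by simp
    _ ≤ ∏ j, a j := Finset.prod_le_prod' fun j _ => h j

end Criterion

end Summit.Ventures.HSemireg
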